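import Summits.CriticalPhenomena.PercolationContinuityZ3.Theorems.PercNearOneGluingNoHeavyLowerTailCILSeparatedStarExpansion
import HarnessLib

/-!
# `NoHeavyLowerTail` (stmt-CriticalPhenomena-4575) — TRIPLE star expansion of the separated margin of a three-observer set

Support file (prover `prim-gen-swap` gen 6; `--supports stmt-CriticalPhenomena-4575`).  No definitions, no named facts, no sorries.

Notation: `μ_w = prodBernoulli w` on `Fin n`, relays `A`, level `j`, `π(S) = {z ∈ A : z ↔ some y ∈ S}`, separated margin of a vertex set `S`
seen from `i`:  `CSdiff_w(S, i) := μ_w(i ↮ S, |π(i)| ≤ j) − μ_w(i ↮ S, 1 ≤ |π(S)| ≤ j)`.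

* `Hyperedge.tripleCSdiff_star_expansion` — for three observers `s₁, s₂, s₃ ∉ A` (pairwise distinct) whose positive pairs end in `P₁, P₂, P₃`
  (`P₂, P₃ ∌ i`, the `P`'s avoiding the three observers), and a vertex `i ∉ {s₁,s₂,s₃}`:
  `CSdiff_w({s₁,s₂,s₃}, i) = Σ_{S ⊆ P₃} μ_w(σ³_S) Σ_{T ⊆ P₂} μ_{w∖s₃}(σ²_T) Σ_{U ⊆ P₁} μ_{w∖s₃∖s₂}(σ¹_U) · f(S ∪ T ∪ U)`, with HONEST cells
  `f(R) = μ_K(i ↮ R, |π(i)| ≤ j) − μ_K(i ↮ R, 1 ≤ |π(R)| ≤ j)` in `K = ((w ∖ s₃) ∖ s₂) ∖ s₁` (all pairs at the three observers switched off).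
  This is `Hyperedge.pairCSdiff_double_star_expansion` (prim-hp-3) iterated once more: `CutObserver.setCSdiff_star_expansion` at `s₃`, `s₂`, `s₁`
  with `Hyperedge.real_reachFunctional_offObserver` after each step.  It is step (1) of the level-two observer-set inequality for THREE
  two-port pendant stars (seat memo R3-SEATS.md §7, blueprint `setCS_twoPortStars_levelTwo`): the cells are relay-set margins in the star-free
  graph `K`, to be regrouped star by star into comonotone / port-glued extremes.
-/

noncomputable section

namespace Summit.CriticalPhenomena.PercolationContinuityZ3.Theorems

open MeasureTheory Set Literature.Probability.LatticeModels Literature.Probability.Percolation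
open scoped Classical BigOperators

variable {n : ℕ}

namespace Hyperedge

open CutObserver KNPreFKG

/-- **Triple star expansion of the three-observer separated margin.**  See the file header:
`CSdiff_w({s₁,s₂,s₃}, i) = Σ_S μ_w(σ³_S) Σ_T μ_{w∖s₃}(σ²_T) Σ_U μ_{(w∖s₃)∖s₂}(σ¹_U) · f(S ∪ T ∪ U)` with honest cells
`f(R) = μ_K(i ↮ R, |π(i)| ≤ j) − μ_K(i ↮ R, 1 ≤ |π(R)| ≤ j)`, `K = ((w∖s₃)∖s₂)∖s₁`. [folklore] -/
theorem tripleCSdiff_star_expansion (w : Sym2 (Fin n) → unitInterval) (A : Finset (Fin n)) (s₁ s₂ s₃ i : Fin n)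
    (P₁ P₂ P₃ : Finset (Fin n)) (j : ℕ) (h1A : s₁ ∉ A) (h2A : s₂ ∉ A) (h3A : s₃ ∉ A)
    (h12 : s₁ ≠ s₂) (h13 : s₁ ≠ s₃) (h23 : s₂ ≠ s₃) (hi1 : i ≠ s₁) (hi2 : i ≠ s₂) (hi3 : i ≠ s₃)
    (h1P1 : s₁ ∉ P₁) (h2P2 : s₂ ∉ P₂) (h3P3 : s₃ ∉ P₃) (h1P2 : s₁ ∉ P₂) (h1P3 : s₁ ∉ P₃) (h2P3 : s₂ ∉ P₃)
    (hiP2 : i ∉ P₂) (hiP3 : i ∉ P₃)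
    (hobs₁ : ∀ y, y ≠ s₁ → y ∉ P₁ → w s(s₁, y) = 0) (hobs₂ : ∀ y, y ≠ s₂ → y ∉ P₂ → w s(s₂, y) = 0)
    (hobs₃ : ∀ y, y ≠ s₃ → y ∉ P₃ → w s(s₃, y) = 0) :
    (prodBernoulli w).real {ω : BondConfig (Fin n) | (∀ x ∈ ({s₁, s₂, s₃} : Finset (Fin n)), ¬ (openGraph ω).Reachable i x) ∧
        (A.filter fun z => (openGraph ω).Reachable i z).card ≤ j} -
      (prodBernoulli w).real {ω : BondConfig (Fin n) | (∀ x ∈ ({s₁, s₂, s₃} : Finset (Fin n)), ¬ (openGraph ω).Reachable i x) ∧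
        1 ≤ (A.filter fun z => ∃ x ∈ ({s₁, s₂, s₃} : Finset (Fin n)), (openGraph ω).Reachable x z).card ∧
        (A.filter fun z => ∃ x ∈ ({s₁, s₂, s₃} : Finset (Fin n)), (openGraph ω).Reachable x z).card ≤ j} =
    ∑ S ∈ P₃.powerset, (prodBernoulli w).real (starEvent s₃ (↑S : Set (Fin n))) *
      ∑ T ∈ P₂.powerset,
        (prodBernoulli (fun e => if s₃ ∈ e then (0 : unitInterval) else w e)).real (starEvent s₂ (↑T : Set (Fin n))) *
        ∑ U ∈ P₁.powerset,
          (prodBernoulli (fun e => if s₂ ∈ e then (0 : unitInterval) else if s₃ ∈ e then (0 : unitInterval) else w e)).real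
              (starEvent s₁ (↑U : Set (Fin n))) *
          ((prodBernoulli (fun e => if s₁ ∈ e then (0 : unitInterval) else if s₂ ∈ e then (0 : unitInterval) else
                if s₃ ∈ e then (0 : unitInterval) else w e)).real
              {ω : BondConfig (Fin n) | (∀ y ∈ S ∪ T ∪ U, ¬ (openGraph ω).Reachable i y) ∧
                (A.filter fun z => (openGraph ω).Reachable i z).card ≤ j} -
            (prodBernoulli (fun e => if s₁ ∈ e then (0 : unitInterval) else if s₂ ∈ e then (0 : unitInterval) else
                if s₃ ∈ e then (0 : unitInterval) else w e)).real
              {ω : BondConfig (Fin n) | (∀ y ∈ S ∪ T ∪ U, ¬ (openGraph ω).Reachable i y) ∧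
                1 ≤ (A.filter fun z => ∃ y ∈ S ∪ T ∪ U, (openGraph ω).Reachable y z).card ∧
                (A.filter fun z => ∃ y ∈ S ∪ T ∪ U, (openGraph ω).Reachable y z).card ≤ j}) := by
  set w₃ : Sym2 (Fin n) → unitInterval := fun e => if s₃ ∈ e then (0 : unitInterval) else w e with hw₃
  set w₃₂ : Sym2 (Fin n) → unitInterval := fun e => if s₂ ∈ e then (0 : unitInterval) else w₃ e with hw₃₂
  -- (1) expand at `s₃`, observer set `{s₁, s₂, s₃}`
  have h3mem : s₃ ∈ ({s₁, s₂, s₃} : Finset (Fin n)) := by simp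
  have himem : i ∉ ({s₁, s₂, s₃} : Finset (Fin n)) := by simp [hi1, hi2, hi3]
  rw [setCSdiff_star_expansion w A ({s₁, s₂, s₃} : Finset (Fin n)) s₃ i P₃ j h3mem h3A himem h3P3 hobs₃]
  have hE3 : ({s₁, s₂, s₃} : Finset (Fin n)).erase s₃ = {s₁, s₂} := by
    ext x
    simp only [Finset.mem_erase, Finset.mem_insert, Finset.mem_singleton]
    constructor
    · rintro ⟨hne, h | h | h⟩
      · exact Or.inl h
      · exact Or.inr h
      · exact absurd h hne
    · rintro (h | h)
      · exact ⟨h ▸ h13, Or.inl h⟩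
      · exact ⟨h ▸ h23, Or.inr (Or.inl h)⟩
  simp only [hE3]
  refine Finset.sum_congr rfl fun S hS => ?_
  have hSP : S ⊆ P₃ := Finset.mem_powerset.1 hS
  have hiS : i ∉ S := fun h => hiP3 (hSP h)
  have h1S : s₁ ∉ S := fun h => h1P3 (hSP h)
  have h2S : s₂ ∉ S := fun h => h2P3 (hSP h)
  congr 1
  -- (2) transport both inner events off `s₃`
  have tR := real_reachFunctional_offObserver w s₃
    (fun R => (∀ y ∈ ({s₁, s₂} : Finset (Fin n)) ∪ S, ¬ R i y) ∧ (A.filter fun z => R i z).card ≤ j)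
  have tL := real_reachFunctional_offObserver w s₃
    (fun R => (∀ y ∈ ({s₁, s₂} : Finset (Fin n)) ∪ S, ¬ R i y) ∧
      1 ≤ (A.filter fun z => ∃ y ∈ ({s₁, s₂} : Finset (Fin n)) ∪ S, R y z).card ∧
      (A.filter fun z => ∃ y ∈ ({s₁, s₂} : Finset (Fin n)) ∪ S, R y z).card ≤ j)
  beta_reduce at tR tL
  -- (3) expand at `s₂` under `w ∖ s₃`, observer set `{s₁, s₂} ∪ S`
  have hobs₂' : ∀ y, y ≠ s₂ → y ∉ P₂ → w₃ s(s₂, y) = 0 := by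
    intro y hy hyP
    simp only [hw₃]
    split_ifs with h
    · rfl
    · exact hobs₂ y hy hyP
  have h2mem : s₂ ∈ (({s₁, s₂} : Finset (Fin n)) ∪ S) := Finset.mem_union_left _ (by simp)
  have himem2 : i ∉ (({s₁, s₂} : Finset (Fin n)) ∪ S) := by
    rw [Finset.mem_union, not_or]
    exact ⟨by simp [hi1, hi2], hiS⟩
  have g2 := setCSdiff_star_expansion w₃ A (({s₁, s₂} : Finset (Fin n)) ∪ S) s₂ i P₂ j h2mem h2A himem2 h2P2 hobs₂'
  have hE2 : ((({s₁, s₂} : Finset (Fin n)) ∪ S).erase s₂) = {s₁} ∪ S := by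
    ext x
    simp only [Finset.mem_erase, Finset.mem_union, Finset.mem_insert, Finset.mem_singleton]
    constructor
    · rintro ⟨hne, (h | h) | h⟩
      · exact Or.inl h
      · exact absurd h hne
      · exact Or.inr h
    · rintro (h | h)
      · exact ⟨h ▸ h12, Or.inl (Or.inl h)⟩
      · exact ⟨fun hx => h2S (hx ▸ h), Or.inr h⟩
  simp only [hE2] at g2
  refine Eq.trans ?_ (Eq.trans g2 ?_)
  · have h2 := congrArg₂ (fun a b : ℝ => a - b) tR tL
    beta_reduce at h2
    convert h2
  refine Finset.sum_congr rfl fun T hT => ?_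
  have hTP : T ⊆ P₂ := Finset.mem_powerset.1 hT
  have hiT : i ∉ T := fun h => hiP2 (hTP h)
  have h1T : s₁ ∉ T := fun h => h1P2 (hTP h)
  congr 1
  -- (4) transport off `s₂`
  have uR := real_reachFunctional_offObserver w₃ s₂
    (fun R => (∀ y ∈ ({s₁} : Finset (Fin n)) ∪ S ∪ T, ¬ R i y) ∧ (A.filter fun z => R i z).card ≤ j)
  have uL := real_reachFunctional_offObserver w₃ s₂
    (fun R => (∀ y ∈ ({s₁} : Finset (Fin n)) ∪ S ∪ T, ¬ R i y) ∧
      1 ≤ (A.filter fun z => ∃ y ∈ ({s₁} : Finset (Fin n)) ∪ S ∪ T, R y z).card ∧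
      (A.filter fun z => ∃ y ∈ ({s₁} : Finset (Fin n)) ∪ S ∪ T, R y z).card ≤ j)
  beta_reduce at uR uL
  -- (5) expand at `s₁` under `(w ∖ s₃) ∖ s₂`, observer set `{s₁} ∪ S ∪ T`
  have hobs₁' : ∀ y, y ≠ s₁ → y ∉ P₁ → w₃₂ s(s₁, y) = 0 := by
    intro y hy hyP
    simp only [hw₃₂, hw₃]
    split_ifs with h h'
    · rfl
    · rfl
    · exact hobs₁ y hy hyP
  have h1mem : s₁ ∈ (({s₁} : Finset (Fin n)) ∪ S ∪ T) :=
    Finset.mem_union_left _ (Finset.mem_union_left _ (Finset.mem_singleton_self _))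
  have himem1 : i ∉ (({s₁} : Finset (Fin n)) ∪ S ∪ T) := by
    rw [Finset.mem_union, Finset.mem_union, Finset.mem_singleton, not_or, not_or]
    exact ⟨⟨hi1, hiS⟩, hiT⟩
  have g1 := setCSdiff_star_expansion w₃₂ A (({s₁} : Finset (Fin n)) ∪ S ∪ T) s₁ i P₁ j h1mem h1A himem1 h1P1 hobs₁'
  have hE1 : ((({s₁} : Finset (Fin n)) ∪ S ∪ T).erase s₁) = S ∪ T := by
    ext x
    simp only [Finset.mem_erase, Finset.mem_union, Finset.mem_singleton]
    constructor
    · rintro ⟨hne, (h | h) | h⟩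
      · exact absurd h hne
      · exact Or.inl h
      · exact Or.inr h
    · rintro (h | h)
      · exact ⟨fun hx => h1S (hx ▸ h), Or.inl (Or.inr h)⟩
      · exact ⟨fun hx => h1T (hx ▸ h), Or.inr h⟩
  simp only [hE1] at g1
  refine Eq.trans ?_ (Eq.trans g1 ?_)
  · have h4 := congrArg₂ (fun a b : ℝ => a - b) uR uL
    beta_reduce at h4
    convert h4
  refine Finset.sum_congr rfl fun U _ => ?_
  congr 1
  -- (6) transport the cells off `s₁`; the cell set `S ∪ T ∪ U`
  have vR := real_reachFunctional_offObserver w₃₂ s₁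
    (fun R => (∀ y ∈ S ∪ T ∪ U, ¬ R i y) ∧ (A.filter fun z => R i z).card ≤ j)
  have vL := real_reachFunctional_offObserver w₃₂ s₁
    (fun R => (∀ y ∈ S ∪ T ∪ U, ¬ R i y) ∧ 1 ≤ (A.filter fun z => ∃ y ∈ S ∪ T ∪ U, R y z).card ∧
      (A.filter fun z => ∃ y ∈ S ∪ T ∪ U, R y z).card ≤ j)
  beta_reduce at vR vL
  have h6 := congrArg₂ (fun a b : ℝ => a - b) vR vL
  beta_reduce at h6
  have hK : (fun e : Sym2 (Fin n) => if s₁ ∈ e then (0 : unitInterval) else if s₂ ∈ e then (0 : unitInterval) else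
      if s₃ ∈ e then (0 : unitInterval) else w e) = (fun e => if s₁ ∈ e then (0 : unitInterval) else w₃₂ e) := by
    funext e
    simp only [hw₃₂, hw₃]
  rw [hK]
  convert h6
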